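import Summits.BirchSwinnertonDyer.BirchSwinnertonDyer.Theorems.QuadraticBranchSignedControlNoFiniteSubmoduleOfMainThmI
import Summits.BirchSwinnertonDyer.Rank1Residual.Iwasawa.NoFiniteSubmoduleOfSelfDualLayers
import HarnessLib

/-!
# (I) = Kitajima–Otsuki Thm. 4.5 for the CLASSICAL tower dual `X(V/ℚ(μ_{p^∞}))` by the Hachimori–Matsuno
# road (classical Cassels–Tate layer package, displayed), hence the KO13 binder and the K8 node (R2±)
# `NoFiniteSubmoduleSigned` from [classical layer package] ∧ (L) — seat g2's reduction with its input
# (I) taken one step further into print (cell `bsd-potss`, seat `bsd-potss-k8q-c5` g3; route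
# `QuadraticBranchSignedControl`, items stmt-BirchSwinnertonDyer-19117 / 19222 / 19233 / 19301)

HONEST FRAMING (cell `bsd-potss`, run/shared/lean/pub/bsd-potss/): THEOREMS ONLY, all CONDITIONAL —
nothing here closes an item. Seat g2 (`…NoFiniteSubmoduleOfMainThmI`) reduced the binder's printed
fact `KitajimaOtsuki2018.mainThm13_towerSignedSelmerDual_noFiniteSubmodule` BY NAME to (I) Kitajima–
Otsuki Thm. 4.5 (the CLASSICAL dual `X(V/ℚ(μ_{p^∞}))` has no non-zero finite `Λ`-submodule) and (L)
([Gre99] Thm. 1.7 ∧ Prop. 3.32). In print (arXiv:1607.03612 §4.1, p. 18) Thm. 4.5 is Matsuno 2003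
Prop. 4.1 — the Cassels–Tate mechanism of Hachimori–Matsuno (Proc. AMS 128 (2000) 2539–2541) for the
CLASSICAL Selmer groups `Sel(V/K_n)` of the layers `K_n` of `ℚ(μ_{p^∞})/ℚ(μ_p)` — fed by Lemma 4.2
(injective layers: `V(ℚ(μ_{p^∞}))[p] = 0`, Kobayashi Lemma 9.1) and Prop. 4.4 (bounded `ℤ_p`-coranks,
from `λ⁺ + λ⁻`, i.e. from (vi)). THIS FILE applies the kernel form of that mechanism (this seat's
`Rank1Residual.Iwasawa.forall_finite_eq_bot_of_selfDualLayers`) to g2's classical tower datum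
`Additive.TowerSelmerDualData`: (I) follows from a DISPLAYED classical Hachimori–Matsuno layer package
on `Sel(V/K_∞)` (injective exhausting `Γ`-stable layers with transitions; corestrictions realising the
norm; `p`-divisible `Γ`-stable `D_n` — the maximal divisible subgroups — whose images stop growing;
`Γ`-invariant biadditive pairings with right kernel exactly `D_n` representing every character of
`L_n/D_n` and making transition/corestriction adjoint — in print: the Cassels–Tate pairing on
`Ш(V/K_n)[p^∞]/div`, Milne ADT I §6, as used by Hachimori–Matsuno). So the binder and the node follow
from [classical layer package] ∧ (L) ∧ Kobayashi Thm. 2.2 — Matsuno's control theory is no longer an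
input BY NAME. NOTHING of the package, of (L) or of Thm. 2.2 is asserted; BSD is not proved by any of
this; no label / mark / count moves.

References: [HachimoriMatsuno2000] Theorem, Corollary (i) (p. 2540); [KitajimaOtsuki2018] Prop. 4.1,
Lemma 4.2, Props. 4.3–4.4, Thm. 4.5, Prop. 3.32, Main Thm. 1.3 (arXiv:1607.03612 pp. 3, 17–19);
[GreenbergLNM1716] Thm. 1.7, §1; [Kobayashi2003] Thm. 2.2 (p. 5), Lemma 9.1 (p. 25); J. S. Milne,
Arithmetic Duality Theorems, I §6 (Cassels–Tate pairing).
-/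

set_option autoImplicit false
-- `Summit.BirchSwinnertonDyer.BirchSwinnertonDyer.…` is the lane's mandated namespace (sub = summit).
set_option linter.dupNamespace false

noncomputable section

open scoped Classical

universe u

open WeierstrassCurve Field Literature.NumberTheory.EllipticCurves
  Literature.NumberTheory.GaloisRepresentations ZpExtension
  Summit.BirchSwinnertonDyer.Rank1Residual Summit.BirchSwinnertonDyer.Rank1Residual.Additive

namespace Summit.BirchSwinnertonDyer.BirchSwinnertonDyer.Theorems

open Summit.BirchSwinnertonDyer.BirchSwinnertonDyer.Theses.QuadraticBranchSignedControl

/-! ## §1 Any classical tower dual datum: no finite `Λ`-submodule from a Hachimori–Matsuno layer package -/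

/-- **`X(E/K_∞)` (classical Selmer dual over the tower `K_∞ = K₀·K^{cyc}`) has no non-zero finite
`Λ`-submodule, given a classical Hachimori–Matsuno layer package on `Sel(E/K_∞)`** — for ANY number
field `K`, `ℤ_p`-extension `κ`, finite Galois `K₀/K`, `γ` and ANY datum
`Dc : Additive.TowerSelmerDualData W κ K₀ γ`. The package is displayed (existential over the layer
data: layers `r_n : L_n → Sel_∞` injective with transitions, exhausting, with a surjective action over
`conj_γ`; corestrictions realising `Σ_{i<p} conj_γ^{pⁿ i}` adjoint to the transitions; `p`-divisible
stable `D_n` with `r_{n+1}(D_{n+1}) ⊆ r_n(D_n)` for `n ≥ m`; invariant pairings with right kernel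
exactly `D_n` representing every character of `L_n/D_n`) — in print the Cassels–Tate pairing on
`Ш(E/K_n)[p^∞]/div` + cofinite generation + injective layers + bounded coranks (Hachimori–Matsuno's
Theorem in the case `𝔛 = 0`; Matsuno 2003 Prop. 4.1). CONDITIONAL; nothing asserted.
[cite: HachimoriMatsuno2000, Theorem and Corollary (i) (p. 2540)]
[cite: KitajimaOtsuki2018, Prop. 4.1, Lemma 4.2, Prop. 4.4, Thm. 4.5 (arXiv:1607.03612 p. 18)] -/
theorem TowerSelmerDualData.forall_finite_eq_bot_of_layerPackage
    {K : Type u} [Field K] [NumberField K] {W : WeierstrassCurve K} {p : ℕ} [Fact p.Prime]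
    {κ : ZpExtension K p} {K₀ : Type u} [Field K₀] [Algebra K K₀] [(galRange (K := K) K₀).Normal]
    {γ : Field.absoluteGaloisGroup K} (Dc : Additive.TowerSelmerDualData W κ K₀ γ)
    (hpack : ∃ (L : ℕ → Type u) (_ : ∀ n, AddCommGroup (L n))
        (r : ∀ n, L n →+ Additive.towerSelmerInfty W κ K₀) (ι : ∀ n, L n →+ L (n + 1))
        (γL : ∀ n, L n →+ L n) (Dn : ∀ n, AddSubgroup (L n))
        (pair : ∀ n, L n →+ L n →+ AddCircle (1 : ℚ)) (m : ℕ),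
      (∀ n, Function.Injective (r n)) ∧
      (∀ n (x : L n), r (n + 1) (ι n x) = r n x) ∧
      (∀ s : Additive.towerSelmerInfty W κ K₀, ∃ n, ∃ x : L n, r n x = s) ∧
      (∀ n (x : L n), r n (γL n x) = Additive.conjTowerSelmerInfty W κ K₀ γ (r n x)) ∧
      (∀ n, Function.Surjective (γL n)) ∧
      (∀ n (t : L (n + 1)), ∃ t' : L n,
        r n t' = ∑ i ∈ Finset.range p,
          ((Additive.conjTowerSelmerInfty W κ K₀ γ) ^ (p ^ n * i)) (r (n + 1) t) ∧
        ∀ y : L n, pair n y t' = pair (n + 1) (ι n y) t) ∧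
      (∀ n, ∀ d ∈ Dn n, ∃ d' ∈ Dn n, p • d' = d) ∧
      (∀ n, ∀ d ∈ Dn n, γL n d ∈ Dn n) ∧
      (∀ n, m ≤ n → (Dn (n + 1)).map (r (n + 1)) ≤ (Dn n).map (r n)) ∧
      (∀ n (t : L n), (∀ y : L n, pair n y t = 0) → t ∈ Dn n) ∧
      (∀ n, ∀ t ∈ Dn n, ∀ y : L n, pair n y t = 0) ∧
      (∀ n (g : L n →+ AddCircle (1 : ℚ)), (∀ d ∈ Dn n, g d = 0) →
        ∃ c : L n, ∀ y : L n, g y = pair n y c) ∧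
      (∀ n (y t : L n), pair n (γL n y) (γL n t) = pair n y t)) :
    ∀ M : Submodule (IwasawaAlgebra p) Dc.X, Finite M → M = ⊥ := by
  obtain ⟨L, instL, r, ι, γL, Dn, pair, m, hr, hι, hex, hγL, hγLs, hcores, hDdiv, hDγ, hDst, hker,
    hD0, hsurj, hinv⟩ := hpack
  exact Iwasawa.forall_finite_eq_bot_of_selfDualLayers p (Additive.conjTowerSelmerInfty W κ K₀ γ) r ι
    γL Dn pair Dc.toDual hr hι hex hγL hγLs hcores hDdiv hDγ m hDst hker hD0 hsurj hinv Dc.bijective.1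
    fun x s ↦ Dc.toDual_T_smul x s

/-! ## §2 (I) for `F = ℚ` from the classical layer packages; the binder and the node from [package] ∧ (L) -/

/-- **(I) — Kitajima–Otsuki's Thm. 4.5 (= Main Thm. I) for `F = ℚ`, in the exact shape consumed by
g2's `mainThm13_tower_of_mainThmI_of_local` — from the DISPLAYED classical Hachimori–Matsuno layer
packages** on `Sel(V/ℚ(μ_{p^∞}))` (one per datum of the binder: `V/ℚ` good at `p ≠ 2` with
`a_p = 0`, `K₀ ⊇ ℚ` cyclotomic of level `p`, `κ` cyclotomic with topological generator `γ` fixing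
`K₀`). CONDITIONAL; Matsuno's Prop. 4.1 replaced, as trusted input, by the Cassels–Tate package.
[cite: KitajimaOtsuki2018, Thm. 4.5, Prop. 4.1, Lemma 4.2, Prop. 4.4 (arXiv:1607.03612 p. 18)]
[cite: HachimoriMatsuno2000, Theorem and Corollary (i) (p. 2540)] -/
theorem mainThmI_of_classicalLayerPackage
    (hC : ∀ (p : ℕ) [Fact p.Prime] (K₀ : Type) [Field K₀] [NumberField K₀]
        [IsCyclotomicExtension {p} ℚ K₀] [(galRange (K := ℚ) K₀).Normal],
      ∀ (V : WeierstrassCurve ℚ) [V.IsElliptic] [V.IsGloballyMinimal],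
        p ≠ 2 → V.HasGoodReductionAtPrime p → V.frobeniusTrace p = 0 →
      ∀ (κ : ZpExtension ℚ p) (γ : Field.absoluteGaloisGroup ℚ),
        κ.IsCyclotomic → κ.IsTopGenerator γ → γ ∈ galRange (K := ℚ) K₀ →
      ∃ (L : ℕ → Type) (_ : ∀ n, AddCommGroup (L n))
        (r : ∀ n, L n →+ Additive.towerSelmerInfty V κ K₀) (ι : ∀ n, L n →+ L (n + 1))
        (γL : ∀ n, L n →+ L n) (Dn : ∀ n, AddSubgroup (L n))
        (pair : ∀ n, L n →+ L n →+ AddCircle (1 : ℚ)) (m : ℕ),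
      (∀ n, Function.Injective (r n)) ∧
      (∀ n (x : L n), r (n + 1) (ι n x) = r n x) ∧
      (∀ s : Additive.towerSelmerInfty V κ K₀, ∃ n, ∃ x : L n, r n x = s) ∧
      (∀ n (x : L n), r n (γL n x) = Additive.conjTowerSelmerInfty V κ K₀ γ (r n x)) ∧
      (∀ n, Function.Surjective (γL n)) ∧
      (∀ n (t : L (n + 1)), ∃ t' : L n,
        r n t' = ∑ i ∈ Finset.range p,
          ((Additive.conjTowerSelmerInfty V κ K₀ γ) ^ (p ^ n * i)) (r (n + 1) t) ∧
        ∀ y : L n, pair n y t' = pair (n + 1) (ι n y) t) ∧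
      (∀ n, ∀ d ∈ Dn n, ∃ d' ∈ Dn n, p • d' = d) ∧
      (∀ n, ∀ d ∈ Dn n, γL n d ∈ Dn n) ∧
      (∀ n, m ≤ n → (Dn (n + 1)).map (r (n + 1)) ≤ (Dn n).map (r n)) ∧
      (∀ n (t : L n), (∀ y : L n, pair n y t = 0) → t ∈ Dn n) ∧
      (∀ n, ∀ t ∈ Dn n, ∀ y : L n, pair n y t = 0) ∧
      (∀ n (g : L n →+ AddCircle (1 : ℚ)), (∀ d ∈ Dn n, g d = 0) →
        ∃ c : L n, ∀ y : L n, g y = pair n y c) ∧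
      (∀ n (y t : L n), pair n (γL n y) (γL n t) = pair n y t)) :
    ∀ (p : ℕ) [Fact p.Prime] (K₀ : Type) [Field K₀] [NumberField K₀]
        [IsCyclotomicExtension {p} ℚ K₀] [(galRange (K := ℚ) K₀).Normal],
      ∀ (V : WeierstrassCurve ℚ) [V.IsElliptic] [V.IsGloballyMinimal],
        p ≠ 2 → V.HasGoodReductionAtPrime p → V.frobeniusTrace p = 0 →
      ∀ (κ : ZpExtension ℚ p) (γ : Field.absoluteGaloisGroup ℚ),
        κ.IsCyclotomic → κ.IsTopGenerator γ → γ ∈ galRange (K := ℚ) K₀ →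
      ∀ (Dc : Additive.TowerSelmerDualData V κ K₀ γ),
        ∀ N : Submodule (IwasawaAlgebra p) Dc.X, Finite N → N = ⊥ :=
  fun p _ K₀ _ _ _ _ V _ _ hp hgood hap κ γ hκ hγ hγ₀ Dc ↦
    TowerSelmerDualData.forall_finite_eq_bot_of_layerPackage Dc
      (hC p K₀ V hp hgood hap κ γ hκ hγ hγ₀)

/-- **The binder's printed-shape fact `KitajimaOtsuki2018.mainThm13_towerSignedSelmerDual_noFiniteSubmodule`
from [classical Cassels–Tate layer package on `Sel(V/ℚ(μ_{p^∞}))`] ∧ (L)** ([Gre99] Thm. 1.7 ∧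
Kitajima–Otsuki Prop. 3.32 with the left half of (4.2)) — g2's `mainThm13_tower_of_mainThmI_of_local`
with (I) supplied by §2. CONDITIONAL on the displayed statements; after this file the trusted print
behind the binder is, by name: Cassels–Tate on the finite layers (Milne I §6 / Hachimori–Matsuno) +
injective layers + bounded coranks, [Gre99] Thm. 1.7, Prop. 3.32 — Kitajima–Otsuki §4 being in the
kernel. [cite: KitajimaOtsuki2018, Main Thm. 1.3 (= Thm. 4.8), Thm. 4.5, Prop. 3.32 (arXiv:1607.03612 pp. 3, 17–19)]
[cite: GreenbergLNM1716, Thm. 1.7] [cite: HachimoriMatsuno2000, Theorem and Corollary (i) (p. 2540)] -/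
theorem mainThm13_tower_of_classicalLayerPackage_of_local
    (hC : ∀ (p : ℕ) [Fact p.Prime] (K₀ : Type) [Field K₀] [NumberField K₀]
        [IsCyclotomicExtension {p} ℚ K₀] [(galRange (K := ℚ) K₀).Normal],
      ∀ (V : WeierstrassCurve ℚ) [V.IsElliptic] [V.IsGloballyMinimal],
        p ≠ 2 → V.HasGoodReductionAtPrime p → V.frobeniusTrace p = 0 →
      ∀ (κ : ZpExtension ℚ p) (γ : Field.absoluteGaloisGroup ℚ),
        κ.IsCyclotomic → κ.IsTopGenerator γ → γ ∈ galRange (K := ℚ) K₀ →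
      ∃ (L : ℕ → Type) (_ : ∀ n, AddCommGroup (L n))
        (r : ∀ n, L n →+ Additive.towerSelmerInfty V κ K₀) (ι : ∀ n, L n →+ L (n + 1))
        (γL : ∀ n, L n →+ L n) (Dn : ∀ n, AddSubgroup (L n))
        (pair : ∀ n, L n →+ L n →+ AddCircle (1 : ℚ)) (m : ℕ),
      (∀ n, Function.Injective (r n)) ∧
      (∀ n (x : L n), r (n + 1) (ι n x) = r n x) ∧
      (∀ s : Additive.towerSelmerInfty V κ K₀, ∃ n, ∃ x : L n, r n x = s) ∧
      (∀ n (x : L n), r n (γL n x) = Additive.conjTowerSelmerInfty V κ K₀ γ (r n x)) ∧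
      (∀ n, Function.Surjective (γL n)) ∧
      (∀ n (t : L (n + 1)), ∃ t' : L n,
        r n t' = ∑ i ∈ Finset.range p,
          ((Additive.conjTowerSelmerInfty V κ K₀ γ) ^ (p ^ n * i)) (r (n + 1) t) ∧
        ∀ y : L n, pair n y t' = pair (n + 1) (ι n y) t) ∧
      (∀ n, ∀ d ∈ Dn n, ∃ d' ∈ Dn n, p • d' = d) ∧
      (∀ n, ∀ d ∈ Dn n, γL n d ∈ Dn n) ∧
      (∀ n, m ≤ n → (Dn (n + 1)).map (r (n + 1)) ≤ (Dn n).map (r n)) ∧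
      (∀ n (t : L n), (∀ y : L n, pair n y t = 0) → t ∈ Dn n) ∧
      (∀ n, ∀ t ∈ Dn n, ∀ y : L n, pair n y t = 0) ∧
      (∀ n (g : L n →+ AddCircle (1 : ℚ)), (∀ d ∈ Dn n, g d = 0) →
        ∃ c : L n, ∀ y : L n, g y = pair n y c) ∧
      (∀ n (y t : L n), pair n (γL n y) (γL n t) = pair n y t))
    (hL : ∀ (p : ℕ) [Fact p.Prime] (K₀ : Type) [Field K₀] [NumberField K₀]
        [IsCyclotomicExtension {p} ℚ K₀] [(galRange (K := ℚ) K₀).Normal],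
      ∀ (V : WeierstrassCurve ℚ) [V.IsElliptic] [V.IsGloballyMinimal],
        p ≠ 2 → V.HasGoodReductionAtPrime p → V.frobeniusTrace p = 0 →
      ∀ (κ : ZpExtension ℚ p) (γ : Field.absoluteGaloisGroup ℚ),
        κ.IsCyclotomic → κ.IsTopGenerator γ → γ ∈ galRange (K := ℚ) K₀ →
      ∀ (ε : ℤˣ) (Dc : Additive.TowerSelmerDualData V κ K₀ γ),
        ((p - 1 : ℕ) : Cardinal) ≤ Module.rank (IwasawaAlgebra p) Dc.X ∧
        ∃ ι : (Fin (p - 1) → IwasawaAlgebra p) →ₗ[IwasawaAlgebra p] Dc.X,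
          ∀ x : Dc.X, x ∈ LinearMap.range ι ↔
            ∀ (s : V.subgroupH1 p (Additive.towerTopSubgroup κ K₀))
              (hs : s ∈ Additive.towerSignedSelmerInfty V κ K₀ ℚ_[p] ε),
              Dc.toDual x ⟨s, Additive.towerSignedSelmerInfty_le_towerSelmerInfty V κ K₀ ℚ_[p] ε hs⟩ = 0) :
    Literature.NumberTheory.EllipticCurves.KitajimaOtsuki2018.mainThm13_towerSignedSelmerDual_noFiniteSubmodule :=
  mainThm13_tower_of_mainThmI_of_local (mainThmI_of_classicalLayerPackage hC) hL

/-- **(R2±) the K8 node `NoFiniteSubmoduleSigned` (item stmt-BirchSwinnertonDyer-19117) from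
[classical Cassels–Tate layer package] ∧ (L) ∧ Kobayashi Thm. 2.2** — g2's node corollary with (I)
supplied by the Hachimori–Matsuno road. CONDITIONAL; closes nothing by itself.
[cite: KitajimaOtsuki2018, Main Thm. 1.3 (= Thm. 4.8), Thm. 4.5, Prop. 3.32 (arXiv:1607.03612 pp. 3, 17–19)]
[cite: GreenbergLNM1716, Thm. 1.7] [cite: Kobayashi2003, Thm. 2.2 (p. 5)]
[cite: HachimoriMatsuno2000, Theorem and Corollary (i) (p. 2540)] -/
theorem noFiniteSubmoduleSigned_of_classicalLayerPackage_of_local_of_kobayashi22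
    (hC : ∀ (p : ℕ) [Fact p.Prime] (K₀ : Type) [Field K₀] [NumberField K₀]
        [IsCyclotomicExtension {p} ℚ K₀] [(galRange (K := ℚ) K₀).Normal],
      ∀ (V : WeierstrassCurve ℚ) [V.IsElliptic] [V.IsGloballyMinimal],
        p ≠ 2 → V.HasGoodReductionAtPrime p → V.frobeniusTrace p = 0 →
      ∀ (κ : ZpExtension ℚ p) (γ : Field.absoluteGaloisGroup ℚ),
        κ.IsCyclotomic → κ.IsTopGenerator γ → γ ∈ galRange (K := ℚ) K₀ →
      ∃ (L : ℕ → Type) (_ : ∀ n, AddCommGroup (L n))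
        (r : ∀ n, L n →+ Additive.towerSelmerInfty V κ K₀) (ι : ∀ n, L n →+ L (n + 1))
        (γL : ∀ n, L n →+ L n) (Dn : ∀ n, AddSubgroup (L n))
        (pair : ∀ n, L n →+ L n →+ AddCircle (1 : ℚ)) (m : ℕ),
      (∀ n, Function.Injective (r n)) ∧
      (∀ n (x : L n), r (n + 1) (ι n x) = r n x) ∧
      (∀ s : Additive.towerSelmerInfty V κ K₀, ∃ n, ∃ x : L n, r n x = s) ∧
      (∀ n (x : L n), r n (γL n x) = Additive.conjTowerSelmerInfty V κ K₀ γ (r n x)) ∧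
      (∀ n, Function.Surjective (γL n)) ∧
      (∀ n (t : L (n + 1)), ∃ t' : L n,
        r n t' = ∑ i ∈ Finset.range p,
          ((Additive.conjTowerSelmerInfty V κ K₀ γ) ^ (p ^ n * i)) (r (n + 1) t) ∧
        ∀ y : L n, pair n y t' = pair (n + 1) (ι n y) t) ∧
      (∀ n, ∀ d ∈ Dn n, ∃ d' ∈ Dn n, p • d' = d) ∧
      (∀ n, ∀ d ∈ Dn n, γL n d ∈ Dn n) ∧
      (∀ n, m ≤ n → (Dn (n + 1)).map (r (n + 1)) ≤ (Dn n).map (r n)) ∧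
      (∀ n (t : L n), (∀ y : L n, pair n y t = 0) → t ∈ Dn n) ∧
      (∀ n, ∀ t ∈ Dn n, ∀ y : L n, pair n y t = 0) ∧
      (∀ n (g : L n →+ AddCircle (1 : ℚ)), (∀ d ∈ Dn n, g d = 0) →
        ∃ c : L n, ∀ y : L n, g y = pair n y c) ∧
      (∀ n (y t : L n), pair n (γL n y) (γL n t) = pair n y t))
    (hL : ∀ (p : ℕ) [Fact p.Prime] (K₀ : Type) [Field K₀] [NumberField K₀]
        [IsCyclotomicExtension {p} ℚ K₀] [(galRange (K := ℚ) K₀).Normal],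
      ∀ (V : WeierstrassCurve ℚ) [V.IsElliptic] [V.IsGloballyMinimal],
        p ≠ 2 → V.HasGoodReductionAtPrime p → V.frobeniusTrace p = 0 →
      ∀ (κ : ZpExtension ℚ p) (γ : Field.absoluteGaloisGroup ℚ),
        κ.IsCyclotomic → κ.IsTopGenerator γ → γ ∈ galRange (K := ℚ) K₀ →
      ∀ (ε : ℤˣ) (Dc : Additive.TowerSelmerDualData V κ K₀ γ),
        ((p - 1 : ℕ) : Cardinal) ≤ Module.rank (IwasawaAlgebra p) Dc.X ∧
        ∃ ι : (Fin (p - 1) → IwasawaAlgebra p) →ₗ[IwasawaAlgebra p] Dc.X,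
          ∀ x : Dc.X, x ∈ LinearMap.range ι ↔
            ∀ (s : V.subgroupH1 p (Additive.towerTopSubgroup κ K₀))
              (hs : s ∈ Additive.towerSignedSelmerInfty V κ K₀ ℚ_[p] ε),
              Dc.toDual x ⟨s, Additive.towerSignedSelmerInfty_le_towerSelmerInfty V κ K₀ ℚ_[p] ε hs⟩ = 0)
    (h22 : Literature.NumberTheory.EllipticCurves.Kobayashi2003.thm22_towerSignedSelmerDual_finite_torsion) :
    NoFiniteSubmoduleSigned :=
  noFiniteSubmoduleSigned_of_mainThm13Tower (mainThm13_tower_of_classicalLayerPackage_of_local hC hL) h22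

end Summit.BirchSwinnertonDyer.BirchSwinnertonDyer.Theorems

end
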